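import Summits.BirchSwinnertonDyer.Rank1Residual.P2.CongruentNumberPairsAtTwo
import Literature.NumberTheory.EllipticCurves.TianYuanZhang2017.ScriptLBridgeProofs
import Literature.NumberTheory.EllipticCurves.TianYuanZhang2017.GenusFieldFamily
import Literature.NumberTheory.EllipticCurves.CongruentNumberCurveConductorSign
import Literature.NumberTheory.EllipticCurves.RootNumberParityProofs
import HarnessLib

/-!
# Sub-lane «bsd-p2»: the SELMER–GENUS BRIDGE at `2` on the rank-zero side — Monsky's `2`-descent bit
# `s(n) = 0` EQUALS Tian–Yuan–Zhang's genus bit `𝓛(n) ≡ Σ₁(n) (mod 2)` for every square-free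
# `n ≡ 1, 3 (mod 8)` (p2-typer GEN 6, OFFER R0-PARITY-BRIDGE)

HONEST FRAMING (sub-lane «bsd-p2», run/shared/lean/b2b/bsd-rank1-residual/p2/, verbatim in every
file): the target of record is the FULL Birch–Swinnerton-Dyer formula for EVERY analytic-rank `≤ 1`
`E/ℚ` at ALL primes INCLUDING `2`; the odd-prime class ledger is referee A's; the `2`-part is OPEN
(cells O1 = X5 ∖ CM and O12 = the CM corner) and under census by «bsd-p2». Census / instrument
output at `2` = EVIDENCE / conjecture items with held-out validation, NEVER a Literature fact;
certificates close PAIRS (one isogeny class, `p = 2`), never classes. This file asserts NO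
arithmetic fact: its theorems are kernel theorems MODULO the displayed journal facts named in their
binders — `hM` (Monsky 1994, `#Sel₂(E_n) = 2^{2+s(n)}`), `hBT` (Burungale–Tian 2026 Thm 1.1, the rank-`0`
`2`-converse), `hH` (Deuring–Hecke continuation), `hBF` (Burungale–Flach 2024 Cor 2), `h11`
(Tian–Yuan–Zhang 2017 Thm 1.1) — the binders of the s = 0 door `forall_bsdp_of_monsky_of_BT_BF_odd`
plus `h11`. FRAMING OF RECORD (p2-lead T-127 (ii), verbatim): an iff between two DECIDABLE bits,
CONDITIONAL modulo the five displayed facts; a NEW-IN-TREE-ONLY combination, not a printed theorem;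
adds 0 n to (K); its value is as a CONSISTENCY INSTRUMENT for the typed p = 2 facts on the rank-0 side
(any square-free n ≡ 1, 2, 3 (8) with det ≠ [Σ₁ odd] refutes the conjunction AS TYPED) and as the
precise rank-0 counterpart of the one-directional rank-1 genus criterion. (Presearch: no printed
statement found; TYZ Rem. 1.3: the BSD formula mod `2` on `n ≡ 1, 2, 3` "can be checked case by case".)
Never a Literature fact; nothing booked; no mark moved; no row of any census changes status.

WHAT IT DOES. For `n = p₁⋯p_k ≡ 1, 3 (mod 8)` (distinct odd primes, ANY `k`) both door currencies of
the rank-zero side are finite `𝔽₂`-computations on the Legendre data of `n`: Monsky's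
`det M(n) ∈ 𝔽₂` (`monskyMatrixOdd`; `det = 1 ⟺ s(n) = 0 ⟺ Sel₂(E_n) = E_n(ℚ)[2]`) and the parity of
TYZ's genus sum `Σ₁(n) = ∑_{n = d₀⋯d_ℓ, dᵢ ≡ 1 (8), i > 0} ∏ g(dᵢ)` (`genusSum₁` over `GenusField`, which
by Thm 1.1 is the parity of `𝓛(n) = √#Ш_an(E_n)`). THE BRIDGE `det_monskyMatrixOdd_eq_one_iff_odd_genusSum₁`:
`det M(n) = 1 ↔ Σ₁(n) odd`, proved THROUGH `L(E_n, 1)`: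
(⇒) `s = 0` ⟹ (door: `hBT`, `hBF`) full BSD, rank `0`, `Ш[2^∞] = 0` ⟹ (lit-1's PROVED normalisation
bridge `bsdTriple_iff_rank_and_cardSha_eq_scriptLSq`) `#Ш = 𝓛(n)²` odd ⟹ (`h11`) `Σ₁` odd;
(⇐) `Σ₁` odd ⟹ (`h11`) `𝓛(n)` odd, `≠ 0` ⟹ `ord_{s=1} L(E_n,s) ≤ 1`, and the order is EVEN — §1 proves
`even_analyticRank_congruentNumberCurve` UNCONDITIONALLY from Koblitz's CM functional equation with sign
`+1` (tree: `congruentNumberCurve_completedL_functional_equation_odd/_even`) through a level-generic copy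
of the tree's order-of-vanishing lemma (`analyticOrderAt_completedLContinuation_one_of_level`: any level
`M`, not only `N_E`, so NO modularity binder) ⟹ `L(E_n, 1) ≠ 0` ⟹ (`hBF`, CM by `ℤ[i]`) full BSD ⟹
`#Ш = 𝓛²` odd, rank `0` ⟹ (Silverman X.4.2, `#E_n(ℚ)[2] = 4`) `#Sel₂ = 4` ⟹ (`hM`) `s = 0` ⟹ `det = 1`.
Typer-desk scan (EVIDENCE, real arithmetic independent of the kernel, `p2/typer/cn/r0_consistency.py`):
`0` disagreements `det ≠ [Σ₁ odd]` on `766 513` square-free `n ≡ 1, 2, 3 (mod 8)` (`ω ≤ 4` odd part,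
`n < 3·10⁶` resp. `10⁶`); at `ω = 3` the landed configuration readings give kernel `1` on exactly the
`Σ₁`-odd configurations (`96` of `256`). The even twin (`n ≡ 2 (mod 8)`, `monskyMatrixEven`) is the same
proof and is left to an append. Unit `b2b-bsdres-p2-typer` GEN 6; NEW file.

References: [HeathBrown1994SelmerCongruentII] Appendix (Monsky), typescript p. 39 L10–L33;
[TianYuanZhang2017] Thm 1.1, Rem. 1.3, §1 (1.1); [BurungaleTian2026] Thm 1.1; [BurungaleFlach2024]
Thm 1.1, Cor 2; [KoblitzECMF1993] Ch. II §5, Theorem (p. 84); [SilvermanAEC2009] App. C §16 Thm C.16.3,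
Thm X.4.2; HOME/p2/typer/TYPING-PLAN.md v1.4.
-/

open Filter Topology
open Matrix Finset NumberField WeierstrassCurve Literature.NumberTheory.EllipticCurves
  Literature.NumberTheory.EllipticCurves.Rank1Residual
  Literature.NumberTheory.EllipticCurves.HeathBrown1994
  Literature.NumberTheory.EllipticCurves.TianYuanZhang2017
  Literature.NumberTheory.QuadraticFields.RedeiReichardt

set_option autoImplicit false

namespace Summit.BirchSwinnertonDyer.Rank1Residual.P2

/-! ## §1 Analytic glue: the analytic rank of `E_n` is even for `n ≡ 1, 2, 3 (mod 8)` (unconditional) -/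

section Analytic

variable (W : WeierstrassCurve ℚ)

/-- **Order of vanishing at the centre, at any level.** For an elliptic `W / ℚ` with entire
`L`-function, an entire continuation `Λ` of `M^{s/2}(2π)^{-s}Γ(s)L(W,s)` (`M ≠ 0`, any level) vanishes
at `s = 1` to order exactly `r_an` (the level-`N_E` case is the tree's
`analyticOrderAt_completedLContinuation_one`; the archimedean factor does not vanish at `1`).
[cite: SilvermanAEC2009, App. C §16, Thm. C.16.3 and the sentence following it] -/
theorem analyticOrderAt_completedLContinuation_one_of_level [W.IsElliptic]
    (hE : W.HasEntireLFunction) {M : ℕ} (hM : M ≠ 0) {Λ : ℂ → ℂ}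
    (hΛ : Λ ∈ W.completedLContinuations M) : analyticOrderAt Λ 1 = W.analyticRank := by
  have hUo : IsOpen {s : ℂ | 0 < s.re} := isOpen_lt continuous_const Complex.continuous_re
  have h1 : (1 : ℂ) ∈ {s : ℂ | 0 < s.re} := by simp
  set h : ℂ → ℂ := fun s ↦ (M : ℂ) ^ (s / 2) * (2 * Real.pi : ℂ) ^ (-s) * Complex.Gamma s
    with hdef
  have hev : Λ =ᶠ[𝓝 1] fun s ↦ h s * W.entireLFunction s := by
    filter_upwards [hUo.mem_nhds h1] with s hs
    exact W.completedLContinuation_eqOn_of_re_pos hE hM hΛ hs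
  rw [analyticOrderAt_congr hev, W.analyticRank_eq_analyticOrderAt hE]
  have hh : AnalyticAt ℂ h 1 :=
    (DifferentiableOn.analyticAt (s := {s : ℂ | 0 < s.re})
      (fun s hs ↦ (differentiableAt_archFactor hM hs).differentiableWithinAt)
      (hUo.mem_nhds h1))
  have hL : AnalyticAt ℂ W.entireLFunction 1 := (W.differentiable_entireLFunction hE).analyticAt 1
  have hh0 : analyticOrderAt h 1 = 0 :=
    hh.analyticOrderAt_eq_zero.mpr (archFactor_ne_zero hM (by simp))
  have := analyticOrderAt_mul hh hL
  rw [hh0, zero_add] at this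
  exact this

/-- **A functional equation with sign `+1` at any level forces an EVEN analytic rank.** If `W / ℚ`
is elliptic with entire `L`-function and some entire `Λ` agrees with `M^{s/2}(2π)^{-s}Γ(s)L(W, s)`
on `Re s > 3/2` (`M ≠ 0`) and satisfies `Λ(s) = Λ(2 − s)`, then `ord_{s=1} L(W, s)` is even:
`G(t) = Λ(1+t)` is even and vanishes to order `r_an` at `0`, so `(−1)^{r_an} = 1`.
[cite: SilvermanAEC2009, App. C §16, Thm. C.16.3 (p. 451)] -/
theorem even_analyticRank_of_functional_equation_one [W.IsElliptic] (hE : W.HasEntireLFunction)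
    {M : ℕ} (hM : M ≠ 0) {Λ : ℂ → ℂ} (hd : Differentiable ℂ Λ)
    (hv : ∀ s : ℂ, 3 / 2 < s.re →
      Λ s = (M : ℂ) ^ (s / 2) * (2 * Real.pi : ℂ) ^ (-s) * Complex.Gamma s * W.LSeries s)
    (hfe : ∀ s : ℂ, Λ s = Λ (2 - s)) : Even W.analyticRank := by
  have hΛ := mem_completedLContinuations_of_eq_LSeries W hd hv
  set G : ℂ → ℂ := fun t ↦ Λ (1 + t) with hGdef
  have hGan : AnalyticAt ℂ G 0 := by
    have hΛ1 : AnalyticAt ℂ Λ (1 + 0) := (hd.analyticAt _)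
    exact hΛ1.comp_of_eq (analyticAt_const.add analyticAt_id) rfl
  have hGord : analyticOrderAt G 0 = W.analyticRank := by
    have hg : AnalyticAt ℂ (fun t : ℂ ↦ 1 + t) 0 := analyticAt_const.add analyticAt_id
    have hg' : deriv (fun t : ℂ ↦ 1 + t) 0 ≠ 0 := by
      rw [deriv_const_add, deriv_id'']
      exact one_ne_zero
    have := analyticOrderAt_comp_of_deriv_ne_zero (f := Λ) hg hg'
    simp only [Function.comp_def, add_zero] at this
    rw [hGdef, this]
    exact analyticOrderAt_completedLContinuation_one_of_level W hE hM hΛ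
  have hGfe : ∀ t : ℂ, G (-t) = (1 : ℂ) * G t := by
    intro t
    simp only [hGdef, one_mul]
    rw [hfe (1 + t)]
    congr 1
    ring
  have key : (-1 : ℂ) ^ W.analyticRank = 1 :=
    Literature.NumberTheory.EllipticCurves.neg_one_pow_eq_of_comp_neg_eq_mul hGan hGord hGfe
  exact (neg_one_pow_eq_one_iff_even (by norm_num)).mp key

variable {n : ℕ}

/-- **`ord_{s=1} L(E_n, s)` is EVEN for square-free `n ≡ 1, 2, 3 (mod 8)`, unconditionally** — the
CM functional equation of `L(E_n, s)` (Koblitz, GTM 97, Ch. II §5; the tree's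
`congruentNumberCurve_completedL_functional_equation_odd/_even`) has sign `χ₋₄(n)χ₈(n) = +1` resp.
`χ₋₄(n/2) = +1` on these classes. [cite: KoblitzECMF1993, Ch. II §5, Theorem (p. 84)]
[cite: TopYui2008Congruent, §3, p. 618] -/
theorem even_analyticRank_congruentNumberCurve (hsq : Squarefree n)
    (h8 : n % 8 = 1 ∨ n % 8 = 2 ∨ n % 8 = 3) :
    haveI := isElliptic_congruentNumberCurve hsq.ne_zero
    Even (congruentNumberCurve n).analyticRank := by
  haveI : NeZero n := ⟨hsq.ne_zero⟩
  haveI := isElliptic_congruentNumberCurve hsq.ne_zero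
  have hE := hasEntireLFunction_congruentNumberCurve_holds hsq
  rcases Nat.even_or_odd n with heven | hodd
  · obtain ⟨d, rfl⟩ := heven.two_dvd
    haveI : NeZero d := ⟨fun h ↦ by simp [h] at hsq⟩
    have hd4 : d % 4 = 1 := by omega
    obtain ⟨Λ, hdiff, hv, hfe⟩ := congruentNumberCurve_completedL_functional_equation_even hsq
    have hχ : ((ZMod.χ₄ d : ℤ) : ℂ) = 1 := by
      rw [ZMod.χ₄_nat_eq_if_mod_four, if_neg (by omega), if_pos hd4]; simp
    exact even_analyticRank_of_functional_equation_one _ hE (M := 64 * d ^ 2)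
      (mul_ne_zero (by norm_num) (pow_ne_zero 2 (NeZero.ne d))) hdiff hv fun s ↦ by
        rw [hfe s, hχ, one_mul]
  · have h8' : n % 8 = 1 ∨ n % 8 = 3 := by
      rcases h8 with h | h | h
      · exact Or.inl h
      · exfalso; rcases hodd with ⟨m, rfl⟩; omega
      · exact Or.inr h
    obtain ⟨Λ, hd, hv, hfe⟩ := congruentNumberCurve_completedL_functional_equation_odd hsq hodd
    exact even_analyticRank_of_functional_equation_one _ hE (M := 32 * n ^ 2)
      (mul_ne_zero (by norm_num) (pow_ne_zero 2 hsq.ne_zero)) hd hv fun s ↦ by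
        rw [hfe s, χ₄_mul_χ₈_eq_one h8', one_mul]

end Analytic

/-! ## §2 Arithmetic glue -/

section Glue

/-- A finite abelian group with trivial `2`-primary component has ODD order (Cauchy).
[cite: SilvermanAEC2009, Thm. X.4.2] -/
theorem odd_natCard_of_primaryComponent_two_eq_bot {G : Type*} [AddCommGroup G] [Finite G]
    (h : AddCommGroup.primaryComponent G 2 = ⊥) : Odd (Nat.card G) := by
  haveI : Fact (Nat.Prime 2) := ⟨Nat.prime_two⟩
  by_contra hodd
  have h2 : 2 ∣ Nat.card G := by
    rw [Nat.odd_iff] at hodd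
    omega
  obtain ⟨g, hg⟩ := exists_prime_addOrderOf_dvd_card' 2 h2
  have hmem : g ∈ AddCommGroup.primaryComponent G 2 := by
    rw [AddCommGroup.mem_primaryComponent]
    refine ⟨1, ?_⟩
    rw [pow_one]
    have := addOrderOf_nsmul_eq_zero g
    rwa [hg] at this
  rw [h, AddSubgroup.mem_bot] at hmem
  rw [hmem, addOrderOf_zero] at hg
  norm_num at hg

/-- In `ZMod 2`, an integer is `1` iff it is odd. [cite: IrelandRosen1990, Ch. 5 §1] -/
theorem intCast_zmod_two_eq_one_iff_odd (L : ℤ) : (L : ZMod 2) = 1 ↔ Odd L := by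
  rw [← Int.not_even_iff_odd, even_iff_two_dvd]
  have h0 : (L : ZMod 2) = 0 ↔ (2 : ℤ) ∣ L := by
    exact_mod_cast ZMod.intCast_zmod_eq_zero_iff_dvd L 2
  rw [← h0]
  have : ∀ x : ZMod 2, x = 1 ↔ ¬ x = 0 := by decide
  exact this _

/-- `𝓛(n)² ≠ 0` forces `ord_{s=1} L(E_n, s) ≤ 1` (the third branch of the definition is `0`).
[cite: TianYuanZhang2017, §1, definition of 𝓛(n) (p0002 L46–L75)] -/
theorem analyticRank_le_one_of_scriptLSq_ne_zero {n : ℕ} (h : scriptLSq n ≠ 0) :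
    (congruentNumberCurve n).analyticRank ≤ 1 := by
  by_contra hle
  apply h
  unfold scriptLSq
  rw [if_neg (by omega), if_neg (by omega)]

/-- From `#Ш(E_n) = 𝓛(n)²` (complex equality) and `L² = 𝓛(n)²`: `#Ш(E_n) = |L|²` in `ℕ`.
[cite: TianYuanZhang2017, §1 (1.1)] -/
theorem natCard_sha_eq_natAbs_sq {n : ℕ} {L : ℤ} (hL : IsScriptL n L)
    (h : ((Nat.card (congruentNumberCurve n).sha : ℕ) : ℂ) = scriptLSq n) :
    Nat.card (congruentNumberCurve n).sha = L.natAbs ^ 2 := by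
  have h2 : ((L.natAbs ^ 2 : ℕ) : ℂ) = (L : ℂ) ^ 2 := by
    rw [Nat.cast_pow, ← Int.cast_natCast, Int.natCast_natAbs, ← Int.cast_pow, sq_abs, Int.cast_pow]
  unfold IsScriptL at hL
  exact_mod_cast (h.trans hL.symm).trans h2.symm


/-- `s(n) = 0` forces `det M = 1` over `𝔽₂` (the kernel of `M` is trivial).
[cite: HeathBrown1994SelmerCongruentII, Appendix (Monsky), typescript p. 39 L33] -/
theorem det_monskyMatrixOdd_eq_one_of_selmerRank_eq_zero {k : ℕ} (p : Fin k → ℕ)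
    (hs : monskySelmerRankOdd p = 0) : (monskyMatrixOdd p).det = 1 := by
  have hker := natCard_ker_mulVecLin_eq (monskyMatrixOdd p)
  have hexp : Fintype.card (Fin k ⊕ Fin k) - (monskyMatrixOdd p).rank = 0 := by
    rw [Fintype.card_sum, Fintype.card_fin, ← two_mul]
    unfold monskySelmerRankOdd at hs
    exact hs
  rw [hexp, pow_zero] at hker
  haveI := (Nat.card_eq_one_iff_unique.mp hker).1
  have hdet : (monskyMatrixOdd p).det ≠ 0 := by
    intro h0
    obtain ⟨v, hv0, hv⟩ := Matrix.exists_mulVec_eq_zero_iff.mpr h0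
    have hmem : v ∈ LinearMap.ker (monskyMatrixOdd p).mulVecLin := by
      rw [LinearMap.mem_ker, Matrix.mulVecLin_apply]; exact hv
    have := Subsingleton.elim (⟨v, hmem⟩ : LinearMap.ker (monskyMatrixOdd p).mulVecLin)
      ⟨0, zero_mem _⟩
    exact hv0 (congrArg Subtype.val this)
  have h01 : ∀ x : ZMod 2, x ≠ 0 → x = 1 := by decide
  exact h01 _ hdet

/-- **The descent count read backwards**: for `n ≠ 0`, rank `0` and `#Ш(E_n)` odd force the exponent
`s` in `#Sel₂(E_n) = 2^{2+s}` to vanish (`#Sel₂ = 2^{rank}·#E(ℚ)[2]·#(Ш ⊓ H¹[2])`, Silverman X.4.2, with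
`#E_n(ℚ)[2] = 4`, so `#(Ш ⊓ H¹[2]) = 2^s` divides the odd number `#Ш`). [cite: SilvermanAEC2009, Thm. X.4.2] -/
theorem selmerRank_eq_zero_of_rank_zero_of_odd_sha {n : ℕ} (hn : n ≠ 0)
    (hrk : haveI := isElliptic_congruentNumberCurve hn; (congruentNumberCurve n).mordellWeilRank = 0)
    (hodd : Odd (Nat.card (congruentNumberCurve n).sha))
    {s : ℕ} (hsel : Nat.card ((congruentNumberCurve n).selmerGroup 2) = 2 ^ (2 + s)) : s = 0 := by
  haveI := isElliptic_congruentNumberCurve hn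
  have hsel' : Nat.card ((congruentNumberCurve n).selmerGroup ((2 : ℕ) : ℤ)) = 2 ^ (2 + s) := by
    simpa only [Nat.cast_ofNat] using hsel
  have hX := (congruentNumberCurve n).natCard_selmerGroup_eq (n := 2) two_ne_zero
  rw [hsel', hrk, pow_zero, one_mul] at hX
  -- `S = #(Ш ⊓ H¹[2])` divides the odd number `#Ш` and equals `2^s` (`#E_n(ℚ)[2] = 4`)
  have hdvd : Nat.card ((congruentNumberCurve n).sha ⊓
      AddSubgroup.torsionBy (congruentNumberCurve n).galH1 ((2 : ℕ) : ℤ) :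
        AddSubgroup (congruentNumberCurve n).galH1) ∣ Nat.card (congruentNumberCurve n).sha :=
    AddSubgroup.card_dvd_of_le inf_le_left
  have aux : ∀ {T S' : ℕ}, 2 ^ (2 + s) = T * S' → T = 4 → S' = 2 ^ s := by
    intro T S' h hT
    subst hT
    have : 2 ^ (2 + s) = 4 * 2 ^ s := by ring
    omega
  have hS := aux hX (by convert Smith2016.natCard_torsionBy_two_congruentNumberCurve hn; norm_num)
  rw [hS] at hdvd
  have hSodd : Odd (2 ^ s) := by
    obtain ⟨m, hm⟩ := hdvd
    rw [hm, Nat.odd_mul] at hodd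
    exact hodd.1
  by_contra hs0
  exact (Nat.not_even_iff_odd.mpr hSodd) (Nat.even_pow.mpr ⟨even_two, hs0⟩)

end Glue

/-! ## §3 THE BRIDGE (odd `n ≡ 1, 3 (mod 8)`): Monsky's `2`-descent bit `s(n) = 0` IS Tian–Yuan–Zhang's
genus bit `𝓛(n) ≡ Σ₁(n) ≡ 1 (mod 2)` -/

section Bridge

variable {k : ℕ} (p : Fin k → ℕ)

/-- **(⇒) `s(n) = 0 ⟹ Σ₁(n)` odd.** For `n = p₁⋯p_k ≡ 1, 3 (mod 8)` (distinct odd primes) with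
`det M = 1` (Monsky: `#Sel₂(E_n) = 4`): rank `0`, `r_an = 0`, `Ш[2^∞] = 0` and the full BSD formula
(the s = 0 door `bsdTriple_of_monsky_of_BT_BF_odd`, modulo `hM hBT hH hBF`); the PROVED bridge
`#Ш(E_n) = 𝓛(n)²` (`bsdTriple_iff_rank_and_cardSha_eq_scriptLSq`) then makes `𝓛(n)` odd, and Thm 1.1
(`h11`) transfers the parity to the genus sum `Σ₁(n)` over `GenusField`.
[cite: HeathBrown1994SelmerCongruentII, Appendix (Monsky), typescript p. 39 L10–L33]
[cite: TianYuanZhang2017, Thm. 1.1 and §1 (1.1)] [cite: BurungaleTian2026, Thm. 1.1]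
[cite: BurungaleFlach2024, Thm. 1.1 and Cor. 2] -/
theorem odd_genusSum₁_of_det_monskyMatrixOdd_eq_one (hM : monsky_card_selmerGroup_two_odd)
    (hBT : burungaleTian_analyticRank_eq_zero_of_selmerCorank_eq_zero_of_hasCM)
    (hH : hasEntireLFunction_of_j_mem_maximalCMJInvariants)
    (hBF : bsdTriple_of_hasCM_of_L_one_ne_zero) (h11 : thm11_parity_of_scriptL)
    (hp : ∀ i, (p i).Prime) (hodd : ∀ i, Odd (p i)) (hinj : Function.Injective p)
    (h8 : (∏ i, p i) % 8 = 1 ∨ (∏ i, p i) % 8 = 3) (hdet : (monskyMatrixOdd p).det = 1) :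
    Odd (genusSum₁ (∏ i, p i) fun d => genusClassNumber (GenusField d)) := by
  have hsq : Squarefree (∏ i, p i) := squarefree_prod_of_injective p hp hinj
  haveI := isElliptic_congruentNumberCurve hsq.ne_zero
  obtain ⟨⟨hBSD, -, hr0⟩, hsha2⟩ := bsdTriple_of_monsky_of_BT_BF_odd p hM hBT hH hBF hp hodd hinj hdet
  obtain ⟨-, hfin, hcard⟩ :=
    (bsdTriple_iff_rank_and_cardSha_eq_scriptLSq hsq (by rw [hr0]; exact zero_le_one)).mp hBSD
  haveI := hfin
  have h8' : (∏ i, p i) % 8 = 1 ∨ (∏ i, p i) % 8 = 2 ∨ (∏ i, p i) % 8 = 3 := by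
    rcases h8 with h | h
    · exact Or.inl h
    · exact Or.inr (Or.inr h)
  obtain ⟨L, hL, hpar⟩ := h11 (∏ i, p i) hsq h8' GenusField (isGenusFieldFamily_genusField _)
  have hShaOdd : Odd (Nat.card (congruentNumberCurve (∏ i, p i)).sha) :=
    odd_natCard_of_primaryComponent_two_eq_bot hsha2
  rw [natCard_sha_eq_natAbs_sq hL hcard, pow_two, Nat.odd_mul] at hShaOdd
  have hLodd : Odd L := Int.natAbs_odd.mp hShaOdd.1
  rw [← ZMod.natCast_eq_one_iff_odd, ← hpar]
  exact (intCast_zmod_two_eq_one_iff_odd L).mpr hLodd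

/-- **(⇐) `Σ₁(n)` odd ⟹ `s(n) = 0`.** For `n = p₁⋯p_k ≡ 1, 3 (mod 8)`: `Σ₁` odd makes `𝓛(n)` odd
(Thm 1.1, `h11`), hence non-zero, so `ord_{s=1} L(E_n, s) ≤ 1`; the order is EVEN (Koblitz's sign `+1`,
`even_analyticRank_congruentNumberCurve`, unconditional), so `L(E_n, 1) ≠ 0`; Burungale–Flach (`hBF`, CM
by `ℤ[i]`) gives the full BSD formula, the proved bridge gives `#Ш(E_n) = 𝓛(n)²` ODD and rank `0`, the
descent count gives `#Sel₂(E_n) = 4`, and Monsky (`hM`) reads `s(n) = 0`, i.e. `det M = 1`.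
[cite: TianYuanZhang2017, Thm. 1.1 and §1 (1.1)] [cite: KoblitzECMF1993, Ch. II §5, Theorem (p. 84)]
[cite: BurungaleFlach2024, Thm. 1.1 and Cor. 2] [cite: HeathBrown1994SelmerCongruentII, Appendix (Monsky), typescript p. 39 L33]
[cite: SilvermanAEC2009, Thm. X.4.2] -/
theorem det_monskyMatrixOdd_eq_one_of_odd_genusSum₁ (hM : monsky_card_selmerGroup_two_odd)
    (hBF : bsdTriple_of_hasCM_of_L_one_ne_zero) (h11 : thm11_parity_of_scriptL)
    (hp : ∀ i, (p i).Prime) (hodd : ∀ i, Odd (p i)) (hinj : Function.Injective p)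
    (h8 : (∏ i, p i) % 8 = 1 ∨ (∏ i, p i) % 8 = 3)
    (hgen : Odd (genusSum₁ (∏ i, p i) fun d => genusClassNumber (GenusField d))) :
    (monskyMatrixOdd p).det = 1 := by
  have hsq : Squarefree (∏ i, p i) := squarefree_prod_of_injective p hp hinj
  haveI := isElliptic_congruentNumberCurve hsq.ne_zero
  haveI := isGloballyMinimal_congruentNumberCurve hsq
  have hE := hasEntireLFunction_congruentNumberCurve_holds hsq
  have h8' : (∏ i, p i) % 8 = 1 ∨ (∏ i, p i) % 8 = 2 ∨ (∏ i, p i) % 8 = 3 := by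
    rcases h8 with h | h
    · exact Or.inl h
    · exact Or.inr (Or.inr h)
  obtain ⟨L, hL, hpar⟩ := h11 (∏ i, p i) hsq h8' GenusField (isGenusFieldFamily_genusField _)
  have hLodd : Odd L := (intCast_zmod_two_eq_one_iff_odd L).mp
    (by rw [hpar]; exact ZMod.natCast_eq_one_iff_odd.mpr hgen)
  have hL0 : (L : ℂ) ≠ 0 := by
    intro h
    have hz : L = 0 := by exact_mod_cast h
    rw [hz] at hLodd
    exact (by decide : ¬ Odd (0 : ℤ)) hLodd
  have hSq0 : scriptLSq (∏ i, p i) ≠ 0 := by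
    unfold IsScriptL at hL
    rw [← hL]
    exact pow_ne_zero 2 hL0
  have hle := analyticRank_le_one_of_scriptLSq_ne_zero hSq0
  have heven := even_analyticRank_congruentNumberCurve hsq h8'
  have hr0 : (congruentNumberCurve (∏ i, p i)).analyticRank = 0 := by
    rcases Nat.le_one_iff_eq_zero_or_eq_one.mp hle with h | h
    · exact h
    · exfalso; rw [h] at heven; exact Nat.not_even_one heven
  have hL1 : (congruentNumberCurve (∏ i, p i)).entireLFunction 1 ≠ 0 := fun h0 =>
    (analyticRank_ne_zero_of_entireLFunction_one_eq_zero (congruentNumberCurve _) hE h0) hr0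
  have hBSD : (congruentNumberCurve (∏ i, p i)).BSDTriple :=
    hBF (congruentNumberCurve _) (LiLiuTian2024.hasCM_congruentNumberCurve _) hL1
  obtain ⟨hrank, -, hcard⟩ := (bsdTriple_iff_rank_and_cardSha_eq_scriptLSq hsq hle).mp hBSD
  have hrk : (congruentNumberCurve (∏ i, p i)).mordellWeilRank = 0 := by
    unfold WeierstrassCurve.BSDRankFormula at hrank
    omega
  have hShaOdd : Odd (Nat.card (congruentNumberCurve (∏ i, p i)).sha) := by
    rw [natCard_sha_eq_natAbs_sq hL hcard]
    exact (Int.natAbs_odd.mpr hLodd).pow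
  have hs0 : monskySelmerRankOdd p = 0 :=
    selmerRank_eq_zero_of_rank_zero_of_odd_sha hsq.ne_zero hrk hShaOdd
      (hM k p hp hodd hinj)
  exact det_monskyMatrixOdd_eq_one_of_selmerRank_eq_zero p hs0

/-- **THE BRIDGE.** For every `n = p₁⋯p_k ≡ 1, 3 (mod 8)` (distinct odd primes, ANY `k`):
Monsky's matrix has `det = 1` (`s(n) = 0`, i.e. `Sel₂(E_n) = E_n[2]`) **iff** Tian–Yuan–Zhang's genus
sum `Σ₁(n) = ∑_{n = d₀⋯d_ℓ, dᵢ ≡ 1 (8), i > 0} ∏ g(dᵢ)` over `GenusField` is ODD — two finite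
`𝔽₂`-computations on the same Legendre data, equal MODULO the displayed journal facts
{`hM` Monsky 1994, `hBT` Burungale–Tian 2026 Thm 1.1, `hH` Deuring–Hecke, `hBF` Burungale–Flach 2024
Cor 2, `h11` TYZ Thm 1.1}; the proof passes through `L(E_n, 1)`. NEW-IN-TREE-ONLY as a combination
(not a printed statement); its use is an ANOMALY INSTRUMENT: a single square-free `n ≡ 1, 3 (mod 8)`
with `det ≠ [Σ₁ odd]` refutes the conjunction of the five facts AS TYPED.
[cite: HeathBrown1994SelmerCongruentII, Appendix (Monsky), typescript p. 39 L10–L33]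
[cite: TianYuanZhang2017, Thm. 1.1, Rem. 1.3 and §1 (1.1)] [cite: BurungaleTian2026, Thm. 1.1]
[cite: BurungaleFlach2024, Thm. 1.1 and Cor. 2] -/
theorem det_monskyMatrixOdd_eq_one_iff_odd_genusSum₁ (hM : monsky_card_selmerGroup_two_odd)
    (hBT : burungaleTian_analyticRank_eq_zero_of_selmerCorank_eq_zero_of_hasCM)
    (hH : hasEntireLFunction_of_j_mem_maximalCMJInvariants)
    (hBF : bsdTriple_of_hasCM_of_L_one_ne_zero) (h11 : thm11_parity_of_scriptL)
    (hp : ∀ i, (p i).Prime) (hodd : ∀ i, Odd (p i)) (hinj : Function.Injective p)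
    (h8 : (∏ i, p i) % 8 = 1 ∨ (∏ i, p i) % 8 = 3) :
    (monskyMatrixOdd p).det = 1 ↔ Odd (genusSum₁ (∏ i, p i) fun d => genusClassNumber (GenusField d)) :=
  ⟨odd_genusSum₁_of_det_monskyMatrixOdd_eq_one p hM hBT hH hBF h11 hp hodd hinj h8,
    det_monskyMatrixOdd_eq_one_of_odd_genusSum₁ p hM hBF h11 hp hodd hinj h8⟩

end Bridge

end Summit.BirchSwinnertonDyer.Rank1Residual.P2
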